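import Mathlib
import HarnessLib
import Summits.ABC.ABC.Theses.CongruentialReceptacle
import Summits.ABC.ABC.Theorems.CongruentialReceptacleCompactBalanceTransferWindowEngine

/-!
# Crux `CompactBalanceTransfer` (stmt-ABC-1725) — window transfer, part 2: UP (Claim B, deep windows)

Support file (`--supports stmt-ABC-1725`) of the line lead `prover-line-stmt-ABC-1725-c8-0` (2026-08-17); see
`…CompactBalanceTransferWindowEngine` for the schema and notation (`h = log c`, `r = log rad(abc)`,
`m = log(c/min(a,b))`).

`abc_of_deepWindow` (STRATEGY-CENSUS §3 S5, Claim B): for `0 < α < 1`, `λ, K ≥ 0` with `α·λ < 1 − α`, abc with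
η-uniform constants `K·η^(−λ)` on the relatively DEEP window `{m ≥ h^α}` implies `ABC`. Mechanism
(`deepWindow_core`): the power map on the small member `(aᴺ, cᴺ − aᴺ, cᴺ)` multiplies depth and height by `N`, so the
relative position `N^(1−α)·m/h^α` reaches `1` at `N = ⌈(h^α/m)^(1/(1−α))⌉ ≤ c₁·h^(α/(1−α))` (`m ≥ log 2`); the engine
absorbs toll, junk and constant exactly when `(α/(1−α))·λ < 1`. Endpoints: `α → 0⁺` is the qualitative
`Negative.DepthCellDissolution` (linear depth cells are abc-complete with NO constant control); at `α = 1` — the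
power-deep cells `{min ≤ c^(1−δ)}` of child 2 of the crux's split (`PowerDeep.freySzpiroToABC_iff_powerDeep`) — the
condition is void (`λ < 0`), matching the census record (§4 D5) that power-deep cells are not known to be abc-complete.
`abc_of_deepWindow_linearConstants`: the instance `λ = 1` (constants `e^(K/η)`, the Robert–Stewart–Tenenbaum order of
growth): every deep window `{m ≥ h^α}` with `α < 1/2` is abc-universal.
Unconditional; hypotheses spelled out (no `def`s); standard axioms; no named facts.
-/

-- `Summit.<Summit>.<Problem>`: for the single-conjunct summit `ABC` the duplicate `ABC.ABC` is mandated.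
set_option linter.dupNamespace false

namespace Summit.ABC.ABC.Theorems.CompactBalanceTransfer.WindowTransfer

open Literature.NumberTheory.DiophantineGeometry
open Summit.ABC.ABC.Theses.CongruentialReceptacle
open Summit.ABC.ABC.Theorems.CompactBalanceTransfer.PowerDeep
open Summit.ABC.ABC.Theorems.CompactBalanceTransfer.Negative

/-! ### Claim B (UP): a deep window with polynomial constants carries all of abc -/

/-- Elementary facts on an abc triple with `a ≤ b`: `0 < a`, `2a ≤ c`, hence `log 2 + log a ≤ log c` and the
depth `m = log c − log a ≥ log 2`. [folklore] -/
theorem log_two_add_log_le {a b c : ℕ} (h : IsABCTriple a b c) (hab : a ≤ b) :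
    Real.log 2 + Real.log (a : ℝ) ≤ Real.log (c : ℝ) := by
  obtain ⟨ha, _, hsum, _⟩ := h
  have h2a : 2 * a ≤ c := by omega
  have haR : (0 : ℝ) < a := by exact_mod_cast ha
  have h2aR : (2 : ℝ) * a ≤ c := by exact_mod_cast h2a
  have h1 := Real.log_le_log (by positivity) h2aR
  rwa [Real.log_mul two_ne_zero haR.ne'] at h1

/-- **Core step of Claim B.** Under the deep-window hypothesis with constants `K·η^(−λ)`, ANY triple with
`a ≤ b` and `log c ≥ 1` is pushed UP into the window `{log c − log min ≥ (log c)^α}` by the power map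
`(aᴺ, cᴺ − aᴺ, cᴺ)` with `N = ⌈((log c)^α / m)^(1/(1−α))⌉`, `m = log c − log a ≥ log 2` (depth and height both
multiply by `N`, so the relative position `N^(1−α)·m/h^α` becomes `≥ 1`; `N = 1` if the triple is already deep), and
the hypothesis at `η = ε/(4N)` yields the tolled window inequality of `height_le_of_tolled_window` at level
`N ≤ ((log 2)^(−1/(1−α)) + 1)·(log c)^(α/(1−α))`. [folklore] -/
theorem deepWindow_core {α lam K ε : ℝ} (hα : 0 < α) (hα1 : α < 1) (hε : 0 < ε) (hε2 : ε ≤ 1 / 2)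
    (hW : ∀ η : ℝ, 0 < η → η ≤ 1 → ∀ a b c : ℕ, IsABCTriple a b c →
      (Real.log (c : ℝ)) ^ α ≤ Real.log (c : ℝ) - Real.log ((min a b : ℕ) : ℝ) →
        Real.log (c : ℝ) ≤ (1 + η) * Real.log ((rad a b c : ℕ) : ℝ) + K * η ^ (-lam))
    {a b c : ℕ} (h : IsABCTriple a b c) (hab : a ≤ b) (h1 : 1 ≤ Real.log (c : ℝ)) :
    ∃ N : ℝ, 1 ≤ N ∧ N ≤ ((Real.log 2)⁻¹ ^ (1 / (1 - α)) + 1) * (Real.log (c : ℝ)) ^ (α / (1 - α)) ∧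
      N * Real.log (c : ℝ) ≤ (1 + ε / (4 * N)) * (Real.log ((rad a b c : ℕ) : ℝ) + Real.log (2 * N) +
        (N - 1) * Real.log (c : ℝ)) + K * (ε / (4 * N)) ^ (-lam) := by
  have hlog2a := log_two_add_log_le h hab
  obtain ⟨ha, hb, hsum, hcop⟩ := h
  have hc : 0 < c := by omega
  have hcR : (0 : ℝ) < c := by exact_mod_cast hc
  have haR : (0 : ℝ) < a := by exact_mod_cast ha
  have hlog2 : (0 : ℝ) < Real.log 2 := Real.log_pos (by norm_num)
  have h1α : 0 < 1 - α := by linarith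
  set hh : ℝ := Real.log (c : ℝ) with hhdef
  set m : ℝ := hh - Real.log (a : ℝ) with hmdef
  have hm2 : Real.log 2 ≤ m := by rw [hmdef]; linarith
  have hmpos : 0 < m := lt_of_lt_of_le hlog2 hm2
  have hhpos : 0 < hh := lt_of_lt_of_le one_pos h1
  have hhα : 0 < hh ^ α := Real.rpow_pos_of_pos hhpos α
  -- the level `N`
  set q : ℝ := (hh ^ α / m) ^ (1 / (1 - α)) with hqdef
  have hq : 0 < q := Real.rpow_pos_of_pos (div_pos hhα hmpos) _
  set Nn : ℕ := ⌈q⌉₊ with hNndef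
  have hNn : 0 < Nn := Nat.ceil_pos.mpr hq
  have hNn0 : Nn ≠ 0 := hNn.ne'
  set N : ℝ := (Nn : ℝ) with hNdef
  have hqN : q ≤ N := Nat.le_ceil q
  have hNq : N < q + 1 := Nat.ceil_lt_add_one hq.le
  have hN1 : (1 : ℝ) ≤ N := by rw [hNdef]; exact Nat.one_le_cast.mpr hNn
  have hNpos : (0 : ℝ) < N := by linarith
  -- the power map `(aᴺ, cᴺ − aᴺ, cᴺ)`
  have hT : IsABCTriple (a ^ Nn) (c ^ Nn - a ^ Nn) (c ^ Nn) := powMap_isABCTriple ⟨ha, hb, hsum, hcop⟩ hNn0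
  have hR : rad (a ^ Nn) (c ^ Nn - a ^ Nn) (c ^ Nn) * c ≤ 2 * c ^ Nn * rad a b c :=
    rad_powMap_mul_le ⟨ha, hb, hsum, hcop⟩ hab hNn0
  have hmin : min (a ^ Nn) (c ^ Nn - a ^ Nn) = a ^ Nn := by
    apply min_eq_left
    have h2a : 2 * a ≤ c := by omega
    have h1' : (2 * a) ^ Nn ≤ c ^ Nn := Nat.pow_le_pow_left h2a Nn
    have h2' : 2 * a ^ Nn ≤ (2 * a) ^ Nn := by
      rw [mul_pow]
      exact Nat.mul_le_mul_right _ (Nat.le_self_pow hNn0 2)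
    omega
  -- logarithms of the power-map data
  have hlogcN : Real.log ((c ^ Nn : ℕ) : ℝ) = N * hh := by
    push_cast; rw [Real.log_pow]
  have hlogaN : Real.log ((a ^ Nn : ℕ) : ℝ) = N * Real.log (a : ℝ) := by
    push_cast; rw [Real.log_pow]
  -- the power map lies in the deep window: `(N h)^α ≤ N m`
  have hwindow : (Real.log ((c ^ Nn : ℕ) : ℝ)) ^ α ≤
      Real.log ((c ^ Nn : ℕ) : ℝ) - Real.log ((min (a ^ Nn) (c ^ Nn - a ^ Nn) : ℕ) : ℝ) := by
    rw [hmin, hlogcN, hlogaN]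
    have e1 : N * hh - N * Real.log (a : ℝ) = N * m := by rw [hmdef]; ring
    rw [e1, Real.mul_rpow hNpos.le hhpos.le]
    -- `q^(1-α) = h^α / m ≤ N^(1-α)`
    have hq1 : q ^ (1 - α) = hh ^ α / m := by
      rw [hqdef, ← Real.rpow_mul (div_pos hhα hmpos).le]
      have : 1 / (1 - α) * (1 - α) = 1 := by field_simp
      rw [this, Real.rpow_one]
    have hN1α : hh ^ α / m ≤ N ^ (1 - α) := by
      rw [← hq1]; exact Real.rpow_le_rpow hq.le hqN h1α.le
    have h2 : hh ^ α ≤ m * N ^ (1 - α) := by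
      rw [div_le_iff₀ hmpos] at hN1α; linarith
    have h3 : N ^ α * hh ^ α ≤ N ^ α * (m * N ^ (1 - α)) :=
      mul_le_mul_of_nonneg_left h2 (Real.rpow_nonneg hNpos.le α)
    have e2 : N ^ α * (m * N ^ (1 - α)) = N * m := by
      have : N ^ α * N ^ (1 - α) = N := by
        rw [← Real.rpow_add hNpos]; norm_num
      calc N ^ α * (m * N ^ (1 - α)) = m * (N ^ α * N ^ (1 - α)) := by ring
        _ = N * m := by rw [this]; ring
    linarith [h3, e2]
  -- apply the window hypothesis at `η = ε/(4N)`
  set η : ℝ := ε / (4 * N) with hηdef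
  have hη : 0 < η := by positivity
  have hη1 : η ≤ 1 := by
    rw [hηdef, div_le_one (by positivity)]; linarith
  have hmain := hW η hη hη1 _ _ _ hT hwindow
  rw [hlogcN] at hmain
  -- radical of the power map: `log rad' ≤ log 2 + (N-1) h + r`
  have hr0 : (0 : ℝ) < ((rad a b c : ℕ) : ℝ) := by exact_mod_cast rad_pos_nat a b c
  have hr'0 : (0 : ℝ) < ((rad (a ^ Nn) (c ^ Nn - a ^ Nn) (c ^ Nn) : ℕ) : ℝ) := by
    exact_mod_cast rad_pos_nat _ _ _
  have hRR : ((rad (a ^ Nn) (c ^ Nn - a ^ Nn) (c ^ Nn) : ℕ) : ℝ) * c ≤ 2 * (c : ℝ) ^ Nn * ((rad a b c : ℕ) : ℝ) := by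
    exact_mod_cast hR
  have hlogr' : Real.log ((rad (a ^ Nn) (c ^ Nn - a ^ Nn) (c ^ Nn) : ℕ) : ℝ) ≤
      Real.log 2 + (N - 1) * hh + Real.log ((rad a b c : ℕ) : ℝ) := by
    have h2 := Real.log_le_log (mul_pos hr'0 hcR) hRR
    rw [Real.log_mul hr'0.ne' hcR.ne', Real.log_mul (by positivity) hr0.ne',
      Real.log_mul two_ne_zero (pow_pos hcR _).ne', Real.log_pow] at h2
    rw [hhdef]; linarith
  have hlog2N : Real.log 2 ≤ Real.log (2 * N) := Real.log_le_log two_pos (by linarith)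
  refine ⟨N, hN1, ?_, ?_⟩
  · -- the level bound `N ≤ c₁ h^p`
    have hp : 0 ≤ α / (1 - α) := div_nonneg hα.le h1α.le
    have hq_le : q ≤ (hh ^ α / Real.log 2) ^ (1 / (1 - α)) := by
      apply Real.rpow_le_rpow (div_pos hhα hmpos).le _ (div_nonneg one_pos.le h1α.le)
      exact div_le_div_of_nonneg_left hhα.le hlog2 hm2
    have e1 : (hh ^ α / Real.log 2) ^ (1 / (1 - α)) = (Real.log 2)⁻¹ ^ (1 / (1 - α)) * hh ^ (α / (1 - α)) := by
      rw [div_eq_mul_inv, Real.mul_rpow hhα.le (inv_nonneg.mpr hlog2.le), ← Real.rpow_mul hhpos.le]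
      have : α * (1 / (1 - α)) = α / (1 - α) := by field_simp
      rw [this]; ring
    have h1p : 1 ≤ hh ^ (α / (1 - α)) := Real.one_le_rpow h1 hp
    rw [e1] at hq_le
    nlinarith [hq_le, h1p, hNq]
  · -- the tolled window inequality
    have h1η : 0 ≤ 1 + η := by linarith
    have h2 : (1 + η) * Real.log ((rad (a ^ Nn) (c ^ Nn - a ^ Nn) (c ^ Nn) : ℕ) : ℝ) ≤
        (1 + η) * (Real.log ((rad a b c : ℕ) : ℝ) + Real.log (2 * N) + (N - 1) * hh) := by
      apply mul_le_mul_of_nonneg_left _ h1η; linarith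
    linarith [hmain, h2]


/-- **Claim B (window transfer UP; STRATEGY-CENSUS §3 S5).** Let `0 < α < 1`, `λ ≥ 0`, `K ≥ 0` with `α·λ < 1 − α`
(i.e. `λ < (1−α)/α`). If abc holds with η-UNIFORM POLYNOMIAL CONSTANTS on the relatively deep window
`{log(c/min(a,b)) ≥ (log c)^α}` — for every `η ∈ (0,1]` and every abc-triple in the window,
`log c ≤ (1+η)·log rad(abc) + K·η^(−λ)` — then the abc conjecture holds for ALL triples. Mechanism: the power map on
the small member (`deepWindow_core`) at level `N ≍ (log c)^(α/(1−α))`, toll `η(N−1)·log c` paid at `η = ε/(4N)`, cost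
`K(4N/ε)^λ ≍ (log c)^(αλ/(1−α)) = o(log c)` exactly when `αλ < 1−α` (`height_le_of_tolled_window`). The qualitative
case `α → 0⁺` (linear depth cells, no constant control needed) is `Negative.DepthCellDissolution`; at `α = 1` (the
power-deep cells of `PowerDeep`, child 2 of the crux's split) the condition is void (`λ < 0`), matching the record
that power-deep cells are not known to be abc-complete. [folklore] -/
theorem abc_of_deepWindow {α lam K : ℝ} (hα : 0 < α) (hα1 : α < 1) (hlam : 0 ≤ lam) (hK : 0 ≤ K)
    (hαl : α * lam < 1 - α)
    (hW : ∀ η : ℝ, 0 < η → η ≤ 1 → ∀ a b c : ℕ, IsABCTriple a b c →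
      (Real.log (c : ℝ)) ^ α ≤ Real.log (c : ℝ) - Real.log ((min a b : ℕ) : ℝ) →
        Real.log (c : ℝ) ≤ (1 + η) * Real.log ((rad a b c : ℕ) : ℝ) + K * η ^ (-lam)) :
    _root_.ABC := by
  rw [ABC_iff]
  intro ε₀ hε₀
  -- work at `ε = min ε₀ (1/2)`
  set ε : ℝ := min ε₀ (1 / 2) with hεdef
  have hε : 0 < ε := lt_min hε₀ (by norm_num)
  have hε2 : ε ≤ 1 / 2 := min_le_right _ _
  have hεle : ε ≤ ε₀ := min_le_left _ _
  have h1α : 0 < 1 - α := by linarith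
  have hlog2 : (0 : ℝ) < Real.log 2 := Real.log_pos (by norm_num)
  set p : ℝ := α / (1 - α) with hpdef
  have hp : 0 ≤ p := div_nonneg hα.le h1α.le
  have hpl : p * lam < 1 := by
    rw [hpdef, div_mul_eq_mul_div, div_lt_one h1α]; exact hαl
  set c₁ : ℝ := (Real.log 2)⁻¹ ^ (1 / (1 - α)) + 1 with hc₁def
  have hc₁ : 0 < c₁ := by
    have : 0 ≤ (Real.log 2)⁻¹ ^ (1 / (1 - α)) := Real.rpow_nonneg (inv_nonneg.mpr hlog2.le) _
    rw [hc₁def]; linarith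
  obtain ⟨K₂, hK₂⟩ := height_le_of_tolled_window hε hε2 hK hlam hp hpl hc₁
  set Kf : ℝ := max K₂ 0 + 1 with hKfdef
  refine ⟨Real.exp Kf, Real.exp_pos Kf, fun a b c habc => ?_⟩
  have hr0 : (0 : ℝ) < ((rad a b c : ℕ) : ℝ) := by exact_mod_cast rad_pos_nat a b c
  have hr1 : (1 : ℝ) ≤ ((rad a b c : ℕ) : ℝ) := by exact_mod_cast rad_pos_nat a b c
  have hlogr : 0 ≤ Real.log ((rad a b c : ℕ) : ℝ) := Real.log_nonneg hr1
  have hcR : (0 : ℝ) < c := by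
    obtain ⟨ha, -, hsum, -⟩ := habc
    exact_mod_cast (show 0 < c by omega)
  -- the logarithmic bound `log c ≤ (1+ε) log rad + max K₂ 0` when `log c ≥ 1`, for `a ≤ b`
  have key : ∀ a' b' : ℕ, IsABCTriple a' b' c → a' ≤ b' → rad a' b' c = rad a b c → 1 ≤ Real.log (c : ℝ) →
      Real.log (c : ℝ) ≤ (1 + ε) * Real.log ((rad a b c : ℕ) : ℝ) + K₂ := by
    intro a' b' h' hab' hrad' h1
    obtain ⟨N, hN1, hNle, hmain⟩ := deepWindow_core hα hα1 hε hε2 hW h' hab' h1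
    rw [hrad'] at hmain
    exact hK₂ _ _ _ (lt_of_lt_of_le one_pos h1) hlogr hN1 hNle hmain
  have hlog : Real.log (c : ℝ) < Kf + (1 + ε) * Real.log ((rad a b c : ℕ) : ℝ) := by
    rcases lt_or_ge (Real.log (c : ℝ)) 1 with hlt | h1
    · have : (0 : ℝ) ≤ max K₂ 0 := le_max_right _ _
      rw [hKfdef]; nlinarith
    · have hK2 : K₂ ≤ max K₂ 0 := le_max_left _ _
      rcases le_total a b with hab | hba
      · have := key a b habc hab rfl h1
        rw [hKfdef]; linarith
      · have := key b a habc.swap hba (rad_swap a b c) h1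
        rw [hKfdef]; linarith
  calc (c : ℝ) = Real.exp (Real.log c) := (Real.exp_log hcR).symm
    _ < Real.exp (Kf + (1 + ε) * Real.log ((rad a b c : ℕ) : ℝ)) := Real.exp_lt_exp.mpr hlog
    _ = Real.exp Kf * ((rad a b c : ℕ) : ℝ) ^ (1 + ε) := by
        rw [Real.exp_add, Real.rpow_def_of_pos hr0, mul_comm (Real.log _)]
    _ ≤ Real.exp Kf * ((rad a b c : ℕ) : ℝ) ^ (1 + ε₀) := by
        apply mul_le_mul_of_nonneg_left _ (Real.exp_pos Kf).le
        exact Real.rpow_le_rpow_of_exponent_le hr1 (by linarith)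

/-- **Claim B at `λ = 1`.** abc with constants `e^(K/η)` (`log C(η) ≤ K/η`, the Robert–Stewart–Tenenbaum order of
growth) on a deep window `{log(c/min) ≥ (log c)^α}` with `α < 1/2` implies `ABC`. [folklore] -/
theorem abc_of_deepWindow_linearConstants {α K : ℝ} (hα : 0 < α) (hα2 : α < 1 / 2) (hK : 0 ≤ K)
    (hW : ∀ η : ℝ, 0 < η → η ≤ 1 → ∀ a b c : ℕ, IsABCTriple a b c →
      (Real.log (c : ℝ)) ^ α ≤ Real.log (c : ℝ) - Real.log ((min a b : ℕ) : ℝ) →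
        Real.log (c : ℝ) ≤ (1 + η) * Real.log ((rad a b c : ℕ) : ℝ) + K / η) :
    _root_.ABC := by
  refine abc_of_deepWindow (lam := 1) hα (by linarith) zero_le_one hK (by linarith) ?_
  intro η hη hη1 a b c habc hwin
  have h := hW η hη hη1 a b c habc hwin
  rwa [Real.rpow_neg_one, ← div_eq_mul_inv]

/-- **Registered sub-goal `deepWindowTransfer` (closed form of `abc_of_deepWindow`, census S5 Claim B).** [folklore] -/
theorem deepWindowTransfer : ∀ α lam K : ℝ, 0 < α → α < 1 → 0 ≤ lam → 0 ≤ K → α * lam < 1 - α →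
    (∀ η : ℝ, 0 < η → η ≤ 1 → ∀ a b c : ℕ, IsABCTriple a b c →
      (Real.log (c : ℝ)) ^ α ≤ Real.log (c : ℝ) - Real.log ((min a b : ℕ) : ℝ) →
        Real.log (c : ℝ) ≤ (1 + η) * Real.log ((rad a b c : ℕ) : ℝ) + K * η ^ (-lam)) → _root_.ABC :=
  fun _ _ _ hα hα1 hlam hK hαl hW => abc_of_deepWindow hα hα1 hlam hK hαl hW

end Summit.ABC.ABC.Theorems.CompactBalanceTransfer.WindowTransfer
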